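import Literature.Computability.QuantumComplexity.RoundedGaussianDomination
import Literature.LinearAlgebra.Matrix.PermanentPerturbation
import Literature.Computability.QuantumComplexity.HaarUnitaryHidingProofs
import HarnessLib

/-!
# The rounded Gaussian matrix: the permanent survives the rounding, and the range event

Family `quantum-advantage`, two REAL-side estimates of the discharge of Aaronson–Arkhipov's Thm. 1.3
(`gpeSolvableInFBPPRel_NPRel_of_approxBosonSamplingOracle`), sequel of `RoundedGaussianDomination.lean`:

* `dyadicComplex_re/im`, `norm_sub_dyadicComplex_roundDyadic_le` — `|w - round_b(w)/2ᵇ| ≤ 2^{-b}`;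
* **`abs_norm_sq_permanent_sub_rounded_le`** — if every entry of `X` has modulus `≤ L` (`L ≥ 1`) then
  `| |Per X|² - |Per(X̃/2ᵇ)|² | ≤ 2n (n!)² (L+1)^{2n} 2^{-b}` (`Matrix.abs_norm_sq_permanent_sub_le`);
* **`real_exists_entry_norm_gt_le`** — `Pr_X[∃ i j, ‖X i j‖ > L] ≤ n² · 2e^{-L²/2}` for `L ≥ 0` (union bound and
  `stdComplexGaussian_real_le_normSq_le`), the probability of the complement of that hypothesis.

All proved.

## References

* S. Aaronson, A. Arkhipov, *The computational complexity of linear optics*, Theory of Computing 9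
  (2013) 143–252, §2 (p. 161: "none of the relevant calculations are affected by precision issues")
  and Lemma 5.3 (p. 185, Gaussian tails).
-/

noncomputable section

namespace Literature.Computability.QuantumComplexity

open MeasureTheory ProbabilityTheory Finset Literature.Computability.Cryptography
  Literature.Computability.Complexity Literature.Probability.Distributions
open scoped NNReal

variable {n : ℕ}

/-! ### The rounding error of one entry -/

/-- `|x - round(2ᵇ x)/2ᵇ| ≤ 2^{-b}/2`. [folklore] -/
theorem abs_sub_round_div_le (b : ℕ) (x : ℝ) : |x - (round ((2 : ℝ) ^ b * x) : ℝ) / 2 ^ b| ≤ ((2 : ℝ) ^ b)⁻¹ / 2 := by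
  have hN : (0 : ℝ) < (2 : ℝ) ^ b := by positivity
  have h := abs_sub_round ((2 : ℝ) ^ b * x)
  rw [show x - (round ((2 : ℝ) ^ b * x) : ℝ) / 2 ^ b = ((2 : ℝ) ^ b * x - round ((2 : ℝ) ^ b * x)) / 2 ^ b by
    field_simp, abs_div, abs_of_pos hN, div_le_iff₀ hN]
  calc |(2 : ℝ) ^ b * x - round ((2 : ℝ) ^ b * x)| ≤ 1 / 2 := h
    _ = ((2 : ℝ) ^ b)⁻¹ / 2 * 2 ^ b := by field_simp

/-- Real part of a dyadic Gaussian rational. [folklore] -/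
theorem dyadicComplex_re (b : ℕ) (z : ℤ × ℤ) : (dyadicComplex b z).re = (z.1 : ℝ) / 2 ^ b := by
  have h2 : ((2 : ℂ)) ^ b = (((2 : ℝ) ^ b : ℝ) : ℂ) := by push_cast; rfl
  rw [dyadicComplex, h2, Complex.div_ofReal_re]
  simp

/-- Imaginary part of a dyadic Gaussian rational. [folklore] -/
theorem dyadicComplex_im (b : ℕ) (z : ℤ × ℤ) : (dyadicComplex b z).im = (z.2 : ℝ) / 2 ^ b := by
  have h2 : ((2 : ℂ)) ^ b = (((2 : ℝ) ^ b : ℝ) : ℂ) := by push_cast; rfl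
  rw [dyadicComplex, h2, Complex.div_ofReal_im]
  simp

/-- **`|w - round_b(w)/2ᵇ| ≤ 2^{-b}`** for the dyadic rounding of a complex number. [folklore] -/
theorem norm_sub_dyadicComplex_roundDyadic_le (b : ℕ) (w : ℂ) :
    ‖w - dyadicComplex b (roundDyadic b w)‖ ≤ ((2 : ℝ) ^ b)⁻¹ := by
  have hre : |(w - dyadicComplex b (roundDyadic b w)).re| ≤ ((2 : ℝ) ^ b)⁻¹ / 2 := by
    rw [Complex.sub_re, dyadicComplex_re]; exact abs_sub_round_div_le b w.re
  have him : |(w - dyadicComplex b (roundDyadic b w)).im| ≤ ((2 : ℝ) ^ b)⁻¹ / 2 := by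
    rw [Complex.sub_im, dyadicComplex_im]; exact abs_sub_round_div_le b w.im
  calc ‖w - dyadicComplex b (roundDyadic b w)‖
      ≤ |(w - dyadicComplex b (roundDyadic b w)).re| + |(w - dyadicComplex b (roundDyadic b w)).im| :=
        Complex.norm_le_abs_re_add_abs_im _
    _ ≤ ((2 : ℝ) ^ b)⁻¹ / 2 + ((2 : ℝ) ^ b)⁻¹ / 2 := add_le_add hre him
    _ = ((2 : ℝ) ^ b)⁻¹ := by ring

/-! ### The permanent survives the rounding -/

/-- **`| |Per X|² - |Per(X̃/2ᵇ)|² | ≤ 2n (n!)² (L+1)^{2n} 2^{-b}`** when every entry of `X` has modulus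
`≤ L` (`L ≥ 1`). [cite: AaronsonArkhipovToC2013, §2 (p. 161)] -/
theorem abs_norm_sq_permanent_sub_rounded_le (b : ℕ) (X : Fin n → Fin n → ℂ) {L : ℝ} (hL : 1 ≤ L)
    (hX : ∀ i j, ‖X i j‖ ≤ L) :
    |‖(Matrix.of X).permanent‖ ^ 2 -
        ‖(Matrix.of fun i j => dyadicComplex b (roundDyadic b (X i j))).permanent‖ ^ 2| ≤
      2 * n * ((n.factorial : ℝ)) ^ 2 * (L + 1) ^ (2 * n) * ((2 : ℝ) ^ b)⁻¹ := by
  have hγ : 0 ≤ ((2 : ℝ) ^ b)⁻¹ := by positivity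
  have hγ1 : ((2 : ℝ) ^ b)⁻¹ ≤ 1 := inv_le_one_of_one_le₀ (one_le_pow₀ (by norm_num))
  have h := Matrix.abs_norm_sq_permanent_sub_le (Matrix.of X)
    (Matrix.of fun i j => dyadicComplex b (roundDyadic b (X i j))) (L := L + 1) (γ := ((2 : ℝ) ^ b)⁻¹)
    (by linarith) hγ (fun i j => (hX i j).trans (by linarith)) (fun i j => ?_) (fun i j => ?_)
  · simpa [Fintype.card_fin] using h
  · -- the rounded entry is within `2^{-b} ≤ 1` of the entry
    have h1 := norm_sub_dyadicComplex_roundDyadic_le b (X i j)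
    have h2 : ‖dyadicComplex b (roundDyadic b (X i j))‖ ≤ ‖X i j‖ + ((2 : ℝ) ^ b)⁻¹ := by
      have := norm_sub_norm_le (dyadicComplex b (roundDyadic b (X i j))) (X i j)
      rw [norm_sub_rev] at h1
      linarith
    simpa using h2.trans (by linarith [hX i j])
  · simpa using norm_sub_dyadicComplex_roundDyadic_le b (X i j)

/-! ### The entry tail -/

/-- **`Pr_X[∃ i j, ‖X i j‖ > L] ≤ n² · 2 e^{-L²/2}`** (union bound over the entries and the
Chernoff tail of the standard complex Gaussian). [cite: AaronsonArkhipovToC2013, Lemma 5.3 (p. 185)] -/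
theorem real_exists_entry_norm_gt_le {L : ℝ} (hL : 0 ≤ L) :
    (gaussianMatrixMeasure n).real {X | ∃ i j, L < ‖X i j‖} ≤ (n : ℝ) ^ 2 * (2 * Real.exp (-(L ^ 2 / 2))) := by
  classical
  have hset : {X : Fin n → Fin n → ℂ | ∃ i j, L < ‖X i j‖} = ⋃ p ∈ (univ : Finset (Fin n × Fin n)), {X | L < ‖X p.1 p.2‖} := by
    ext X; simp
  rw [hset]
  refine (measureReal_biUnion_finset_le _ _).trans ?_
  have hterm : ∀ p : Fin n × Fin n, (gaussianMatrixMeasure n).real {X | L < ‖X p.1 p.2‖} ≤ 2 * Real.exp (-(L ^ 2 / 2)) := by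
    intro p
    have hS : MeasurableSet {z : ℂ | L < ‖z‖} := measurableSet_lt measurable_const continuous_norm.measurable
    rw [show {X : Fin n → Fin n → ℂ | L < ‖X p.1 p.2‖} = {X | X p.1 p.2 ∈ {z : ℂ | L < ‖z‖}} from rfl,
      gaussianMatrixMeasure_real_entry n p.1 p.2 hS]
    refine (measureReal_mono (fun z hz => ?_)).trans (stdComplexGaussian_real_le_normSq_le (L ^ 2))
    simp only [Set.mem_setOf_eq] at hz ⊢
    nlinarith [norm_nonneg z]
  calc ∑ p ∈ (univ : Finset (Fin n × Fin n)), (gaussianMatrixMeasure n).real {X | L < ‖X p.1 p.2‖}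
      ≤ ∑ _p ∈ (univ : Finset (Fin n × Fin n)), 2 * Real.exp (-(L ^ 2 / 2)) := Finset.sum_le_sum fun p _ => hterm p
    _ = (n : ℝ) ^ 2 * (2 * Real.exp (-(L ^ 2 / 2))) := by
        rw [Finset.sum_const, Finset.card_univ, Fintype.card_prod, Fintype.card_fin, nsmul_eq_mul]
        push_cast; ring

end Literature.Computability.QuantumComplexity
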